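import Summits.QuantumFields.YangMills.Theorems.UnitScaleTiltProp7TracePairing
import Summits.QuantumFields.YangMills.Theorems.UnitScaleTiltProp7SectET3RealCoordSums
import HarnessLib

/-!
# Route `UnitScaleTilt`, crux K1 child «MinimiserStabilityRegPr» (stmt-QuantumFields-19200), skeleton v10, stub `stub_existenceMinimalOrbit` (EX), route (α) —
# **R2a (Q1) OF THE (P2-core) PLAN v2: THE COVARIANT BLOCK POINCARÉ INEQUALITY ON THE KERNEL OF A BLOCK MEAN, `ℓ²` FORM, IN BRICK L0a's HILBERT LETTERS** —
# `‖toL2S l‖² ≤ 2·‖D^η_{U₀}(toL2S l)‖²` for every gauge parameter `l` whose REFERENCE block means vanish, the reference mean being ANY family of coefficient maps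
# `Φ y r : M₂ → M₂` within `δ` of the comb conjugations `Ad U₀(Γ_{ȳ,x_r})` (the nested covariant mean `ns_k` of ✓`Prop7SymAvgTwSGaugeDir.QTwS_gaugeDir_of_avgSeq` is such a
# family by linearity of its recursion + tower closeness — DISPLAYED here as the pair (`hΦ`, `hmean`), the «cut at the comb mean» of ★w5-20520 g7's word 17:50:35Z); constant
# `C_P² = 2`, free of `L`, of `k = K − n` and of the volume (ym3-torus-px20 g0's `LOCATE-R2a-NestedMeanPoincare-px20.md`; ★w5-20520 g7's R2 plan v2, ★px10 g0's R2 DESIGN (Q1)).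

Cell `ym3-torus`, width seat `ym3-torus-px20` (gen 0; WIDTH COPY of ym3-torus-p1).  THEOREMS ONLY (0 `def`, 0 `sorry`).  `--supports stmt-QuantumFields-19200 --as helper`,
count-neutral.  YM₃ on T³ is a ladder rung (R3), not the Clay problem; nothing here claims the stub, the crux, d = 4 or the mass gap.

THE MECHANISM ([Balaban1983RegularityDecay] (2.27) in the comb gauge, [Balaban1985Averaging] pp. 24–25; the tree's ✓`Prop7CovariantCoercivity.block_poincare_comb`): on each top
block `B(y)`, `Σ_x‖f‖² ≤ (N∕4)(L^e)²Σ‖∇^Vf‖² + N d(dna)²(L^e)²Σ‖f‖² + N L^{−ed}‖Σ_x Ad_{V(Γ_{ȳ,x})}f(x)‖²`; summed over the blocks (✓`sum_bsite`), with the comb mean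
`Σ_r Ad_{comb} f_r = Σ_r (Ad_{comb} − Φ_r) f_r` when `Σ_r Φ_r f_r = 0`, so `‖·‖² ≤ δ² L^{ed} Σ_r ‖f_r‖²` — a zeroth-order term `N δ²Σ‖f‖²` absorbed with the curvature term; then the
Frobenius∕operator-norm dictionary of brick L0a (`‖toL2S l‖² = c₀ΣΣ|l_{jk}|²`, `‖D^η(toL2S l)‖² = c₀η⁻²Σ_b‖U₀(b)l(b₊)U₀(b)⋆ − l(b₋)‖_F²`, `η·L^{K−n} = 1`).

WHAT IS PROVED (sorry-free, no definition; ns `…Theorems.Prop7NestedMeanPoincare`):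
* §1 (any `P`, levels `i = i′ + …`, `e`, `N`): `norm_sum_sub_le_of_ref` (the reference swap), ★★`sum_normSq_le_combMean_add_covGrad` (the site-function block Poincaré summed over
  the torus, comb mean kept), ★★`sum_normSq_le_covGrad_of_refMean_eq_zero` (`N d³((L^e)²a)² + Nδ² ≤ ½` and vanishing reference means ⇒ `Σ‖f‖² ≤ (N∕2)(L^e)²Σ‖∇^Vf‖²`).
* §2 (T³ member `F`, `n ≤ K`, `SU(2)`, brick L0a letters): `normSq_toL2S_eq`, `normSq_DL2_toL2S_eq` (the dictionary), ★★★`normSq_toL2S_le_two_mul_of_refMean_eq_zero` — THE ROW: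
  `dist1(U₀(∂p)) ≤ ε·L^{−2(K−n)}`, `108ε² + 4δ² ≤ 1`, `hΦ`, `hmean` ⊢ `‖toL2S F K c₀ l‖² ≤ 2·‖DL2 F n K c₀ U₀ (toL2S F K c₀ l)‖²`.
HONEST SCOPE.  The identification «`ns_k l = 0` ⇒ (`hΦ`, `hmean`) with `δ ≤ 0.35`» (linearity of the `avgSeq` recursion; nested-stair transports by averaged bonds vs comb transports:
two-stair Stokes + tower closeness) is NOT here (R2a′).  No sup norm, no decay; nothing of print is asserted; no stub ∕ crux statement is advanced.

References: T. Bałaban, CMP 89 (1983) 571–597 [Balaban1983RegularityDecay] ((2.27) p.580); CMP 98 (1985) 17–51 [Balaban1985Averaging] ((18)–(19) p.21, pp.24–25); CMP 99 (1985) 389–434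
[Balaban1985BackgroundPropagators] ((3.3) p.391, (3.11) p.392, (3.21)–(3.23) p.394, Thm 3.11 p.416); CMP 102 (1985) 277–309 [Balaban1985Variational] ((14) p.280).
-/

set_option autoImplicit false

noncomputable section

open scoped BigOperators Matrix.Norms.L2Operator InnerProductSpace

namespace Summit.QuantumFields.YangMills.Theorems.Prop7NestedMeanPoincare

open Literature.MathematicalPhysics.QuantumFieldTheory.Balaban1983to89
open Finset B1RG242Torus
open B7Prop1Explicit (treeWord plaqWord U1)
open B7Eq78Linearization (conjR conjR_apply conjR_sub)
open B8Ineq132 (norm_conjR)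
open B10Eq27TorusAxialLog (holT unitsField toUField val_unitsField)
open Beta.CoordCubePoincare (stepUp)
open B5Leaf237C0Torus (bsite bsite_stepUp sum_bsite proj_bsite sum_chart)
open Summit.QuantumFields.YangMills.Theorems.Prop7CovariantCoercivity (block_poincare_comb bsite_zero_eq_fibreSite hyp_of_specialUnitary sum_norm_sq_le_mul_opNorm_sq)

variable {N : ℕ} [NeZero N]

/-! ## §1 The site-function block Poincaré inequality summed over the torus, and the reference-mean swap -/

section Assembly

variable {P : Params} {i i' e : ℕ}

omit [NeZero N] in
/-- the reference swap: if the reference coefficients annihilate `f` (`Σ_r Φ_r(f_r) = 0`) and each `Φ_r` is within `δ` of the comb conjugation `C_r` (`‖Φ_r X − C_r X‖ ≤ δ‖X‖`),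
then `‖Σ_r C_r(f_r)‖² ≤ δ²·card·Σ_r‖f_r‖²` (triangle inequality + Cauchy–Schwarz). [folklore] -/
theorem norm_sum_sub_le_of_ref {ι : Type*} [Fintype ι] (C Φ : ι → Matrix (Fin N) (Fin N) ℂ → Matrix (Fin N) (Fin N) ℂ) (f : ι → Matrix (Fin N) (Fin N) ℂ) {δ : ℝ}
    (hδ : 0 ≤ δ) (hΦ : ∀ r X, ‖Φ r X - C r X‖ ≤ δ * ‖X‖) (hmean : ∑ r, Φ r (f r) = 0) :
    ‖∑ r, C r (f r)‖ ^ 2 ≤ δ ^ 2 * Fintype.card ι * ∑ r, ‖f r‖ ^ 2 := by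
  have h1 : ∑ r, C r (f r) = ∑ r, (C r (f r) - Φ r (f r)) := by
    rw [Finset.sum_sub_distrib, hmean, sub_zero]
  have h2 : ‖∑ r, C r (f r)‖ ≤ ∑ r, δ * ‖f r‖ := by
    rw [h1]
    refine (norm_sum_le _ _).trans (Finset.sum_le_sum fun r _ => ?_)
    rw [norm_sub_rev]; exact hΦ r (f r)
  have h3 : (∑ r, δ * ‖f r‖) ^ 2 ≤ Fintype.card ι * ∑ r, (δ * ‖f r‖) ^ 2 := by
    have := sq_sum_le_card_mul_sum_sq (s := (Finset.univ : Finset ι)) (f := fun r => δ * ‖f r‖)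
    simpa using this
  have h0 : 0 ≤ ∑ r, δ * ‖f r‖ := Finset.sum_nonneg fun r _ => mul_nonneg hδ (norm_nonneg _)
  calc ‖∑ r, C r (f r)‖ ^ 2 ≤ (∑ r, δ * ‖f r‖) ^ 2 := pow_le_pow_left₀ (norm_nonneg _) h2 2
    _ ≤ Fintype.card ι * ∑ r, (δ * ‖f r‖) ^ 2 := h3
    _ = δ ^ 2 * Fintype.card ι * ∑ r, ‖f r‖ ^ 2 := by
        rw [Finset.mul_sum, Finset.mul_sum]
        refine Finset.sum_congr rfl fun r _ => ?_
        ring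

/-- ★★ **THE COMB-GAUGE BLOCK POINCARÉ INEQUALITY FOR SITE FUNCTIONS, SUMMED OVER THE TORUS** (✓`block_poincare_comb` on every block `B^e(y)`, `y : Site P i′`, summed by
✓`sum_bsite`; the comb mean KEPT): for a unitary background `V` on `T^{(i)}` with plaquette variables within `a` of `1` and every `M_N(ℂ)`-valued site function `f`,
`Σ_x‖f x‖² ≤ (N∕4)(L^e)²·Σ_νΣ_x‖(∇^V_νf)(x)‖² + N d³((L^e)²a)²·Σ_x‖f x‖² + N(L^{ed})⁻¹·Σ_y‖Σ_{r} Ad_{V(Γ_{ȳ,x_r})} f(x_r)‖²` (`ȳ` the block corner, `Γ` the comb contour,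
`(∇^V_νf)(x) = Ad_{V(x,x+e_ν)}f(x+e_ν) − f(x)`). [cite: Balaban1983RegularityDecay, (2.27) p.580; Balaban1985Averaging, pp.24–25; Balaban1985BackgroundPropagators, Thm 3.11 p.416] -/
theorem sum_normSq_le_combMean_add_covGrad {V : GaugeField P i (Matrix (Fin N) (Fin N) ℂ)ˣ} (hV : ∀ b, V b ∈ U1 (Matrix (Fin N) (Fin N) ℂ))
    {a : ℝ} (ha : 0 ≤ a)
    (hplaq : ∀ (x : Site P i) (κ μ : Fin P.d), κ ≠ μ → ‖((holT V x (plaqWord κ μ) : (Matrix (Fin N) (Fin N) ℂ)ˣ) : Matrix (Fin N) (Fin N) ℂ) - 1‖ ≤ a)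
    (h : P.sitesPerDir i = P.L ^ e * P.sitesPerDir i') (f : Site P i → Matrix (Fin N) (Fin N) ℂ) :
    ∑ x : Site P i, ‖f x‖ ^ 2
      ≤ (N / 4) * ((P.L : ℝ) ^ e) ^ 2 * ∑ ν : Fin P.d, ∑ x : Site P i, ‖conjR (V ⟨x, ν⟩) (f (x.shift ν)) - f x‖ ^ 2
        + N * P.d ^ 3 * (((P.L : ℝ) ^ e) ^ 2 * a) ^ 2 * ∑ x : Site P i, ‖f x‖ ^ 2
        + N * (((P.L : ℝ) ^ e) ^ P.d)⁻¹ *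
            ∑ y : Site P i', ‖∑ r : Fin P.d → Fin (P.L ^ e),
                conjR (holT V (Site.fibreSite i e y fun _ => ⟨0, pow_pos P.L_pos e⟩) (treeWord fun ν => ((r ν : ℕ) : ℤ))) (f (Site.fibreSite i e y r))‖ ^ 2 := by
  obtain ⟨n, hn⟩ : ∃ n, n + 1 = P.L ^ e := ⟨P.L ^ e - 1, Nat.sub_add_cancel (Nat.one_le_pow _ _ P.L_pos)⟩
  have hLe : ((P.L : ℝ) ^ e) = (n : ℝ) + 1 := by exact_mod_cast hn.symm
  set D : Fin P.d → Site P i → ℝ := fun ν x => ‖conjR (V ⟨x, ν⟩) (f (x.shift ν)) - f x‖ ^ 2 with hD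
  set Cm : Site P i' → Matrix (Fin N) (Fin N) ℂ := fun y => ∑ r : Fin P.d → Fin (n + 1),
      conjR (holT V (bsite P i e hn y fun _ => 0) (treeWord fun ν => ((r ν : ℕ) : ℤ))) (f (bsite P i e hn y r)) with hCm
  -- (1) per block
  have hper : ∀ y : Site P i', ∑ r : Fin P.d → Fin (n + 1), ‖f (bsite P i e hn y r)‖ ^ 2
      ≤ (N / 4) * ((n : ℝ) + 1) ^ 2 * ∑ ν : Fin P.d, ∑ r ∈ univ.filter (fun r : Fin P.d → Fin (n + 1) => r ν ≠ Fin.last n), D ν (bsite P i e hn y r)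
        + N * (P.d * ((P.d * n * a) ^ 2 * ((n : ℝ) + 1) ^ 2)) * ∑ r : Fin P.d → Fin (n + 1), ‖f (bsite P i e hn y r)‖ ^ 2
        + N * (((n : ℝ) + 1) ^ P.d)⁻¹ * ‖Cm y‖ ^ 2 := by
    intro y
    have h1 := block_poincare_comb hV ha hplaq hn y f
    simp only [hD, hCm]
    exact h1
  -- (2) sum over the blocks
  have hsum := Finset.sum_le_sum fun y (_ : y ∈ (Finset.univ : Finset (Site P i'))) => hper y
  rw [← sum_bsite P h hn (fun x => ‖f x‖ ^ 2)] at hsum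
  simp only [Finset.sum_add_distrib, ← Finset.mul_sum] at hsum
  -- (3) the global sums
  have eG : ∀ ν : Fin P.d, ∑ y : Site P i', ∑ r ∈ univ.filter (fun r : Fin P.d → Fin (n + 1) => r ν ≠ Fin.last n), D ν (bsite P i e hn y r)
      ≤ ∑ x : Site P i, D ν x := by
    intro ν
    rw [sum_bsite P h hn (D ν)]
    exact Finset.sum_le_sum fun y _ => Finset.sum_le_sum_of_subset_of_nonneg (Finset.filter_subset _ _) fun _ _ _ => by
      simp only [hD]; exact sq_nonneg _
  have eG' : ∑ y : Site P i', ∑ ν : Fin P.d, ∑ r ∈ univ.filter (fun r : Fin P.d → Fin (n + 1) => r ν ≠ Fin.last n), D ν (bsite P i e hn y r)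
      ≤ ∑ ν : Fin P.d, ∑ x : Site P i, D ν x := by
    rw [Finset.sum_comm]
    exact Finset.sum_le_sum fun ν _ => eG ν
  have eF : ∑ y : Site P i', ∑ r : Fin P.d → Fin (n + 1), ‖f (bsite P i e hn y r)‖ ^ 2 = ∑ x : Site P i, ‖f x‖ ^ 2 :=
    (sum_bsite P h hn (fun x => ‖f x‖ ^ 2)).symm
  have eA : ∑ y : Site P i', ‖Cm y‖ ^ 2 = ∑ y : Site P i', ‖∑ r : Fin P.d → Fin (P.L ^ e),
      conjR (holT V (Site.fibreSite i e y fun _ => ⟨0, pow_pos P.L_pos e⟩) (treeWord fun ν => ((r ν : ℕ) : ℤ))) (f (Site.fibreSite i e y r))‖ ^ 2 := by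
    refine Finset.sum_congr rfl fun y _ => ?_
    simp only [hCm]
    rw [← bsite_zero_eq_fibreSite hn y]
    congr 2
    exact (Equiv.piCongrRight fun _ : Fin P.d => finCongr hn).sum_comp
      (fun r : Fin P.d → Fin (P.L ^ e) =>
        conjR (holT V (bsite P i e hn y fun _ => 0) (treeWord fun ν => ((r ν : ℕ) : ℤ))) (f (Site.fibreSite i e y r)))
  -- (4) the coefficient of the zeroth-order term: `d·(dna)²·(n+1)² ≤ d³((n+1)²a)²`
  have hS0 : 0 ≤ ∑ x : Site P i, ‖f x‖ ^ 2 := Finset.sum_nonneg fun _ _ => sq_nonneg _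
  have hcoef : (N : ℝ) * (P.d * ((P.d * n * a) ^ 2 * ((n : ℝ) + 1) ^ 2)) ≤ N * P.d ^ 3 * ((((n : ℝ) + 1) ^ 2) * a) ^ 2 := by
    have hn1 : (n : ℝ) ≤ (n : ℝ) + 1 := by linarith
    have hn0 : (0 : ℝ) ≤ n := Nat.cast_nonneg _
    have e1 : (N : ℝ) * (P.d * ((P.d * n * a) ^ 2 * ((n : ℝ) + 1) ^ 2)) = N * P.d ^ 3 * a ^ 2 * ((n : ℝ) + 1) ^ 2 * (n : ℝ) ^ 2 := by ring
    have e2 : (N : ℝ) * P.d ^ 3 * ((((n : ℝ) + 1) ^ 2) * a) ^ 2 = N * P.d ^ 3 * a ^ 2 * ((n : ℝ) + 1) ^ 2 * ((n : ℝ) + 1) ^ 2 := by ring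
    rw [e1, e2]
    have : (n : ℝ) ^ 2 ≤ ((n : ℝ) + 1) ^ 2 := pow_le_pow_left₀ hn0 hn1 2
    exact mul_le_mul_of_nonneg_left this (by positivity)
  have hgradN : (0 : ℝ) ≤ (N / 4) * ((n : ℝ) + 1) ^ 2 := by positivity
  have hm1 := mul_le_mul_of_nonneg_left eG' hgradN
  have hm2 := mul_le_mul_of_nonneg_right hcoef hS0
  rw [hLe, ← eA]
  rw [eF] at hsum
  simp only [hD] at hsum hm1 eG' ⊢
  nlinarith [hsum, hm1, hm2]

/-- ★★ **SMALL-FIELD FORM ON THE KERNEL OF A REFERENCE BLOCK MEAN**: if the plaquette variables of `V` are within `a` of `1`, the reference coefficients `Φ y r` are within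
`δ` of the comb conjugations (`‖Φ y r X − Ad_{V(Γ_{ȳ,x_r})}X‖ ≤ δ‖X‖`), `N d³((L^e)²a)² + Nδ² ≤ ½`, and the reference block means of `f` vanish (`Σ_r Φ y r (f x_{y,r}) = 0` for every block
`y`), then `Σ_x‖f x‖² ≤ (N∕2)(L^e)²·Σ_νΣ_x‖(∇^V_νf)(x)‖²` — the `(L^e)²` Poincaré bound of the covariant gradient on the kernel of the mean, constants independent of the volume
and of `e`. [cite: Balaban1985BackgroundPropagators, Thm 3.11 p.416; Balaban1983RegularityDecay, (2.27) p.580] -/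
theorem sum_normSq_le_covGrad_of_refMean_eq_zero {V : GaugeField P i (Matrix (Fin N) (Fin N) ℂ)ˣ} (hV : ∀ b, V b ∈ U1 (Matrix (Fin N) (Fin N) ℂ))
    {a δ : ℝ} (ha : 0 ≤ a) (hδ : 0 ≤ δ)
    (hplaq : ∀ (x : Site P i) (κ μ : Fin P.d), κ ≠ μ → ‖((holT V x (plaqWord κ μ) : (Matrix (Fin N) (Fin N) ℂ)ˣ) : Matrix (Fin N) (Fin N) ℂ) - 1‖ ≤ a)
    (hsmall : N * P.d ^ 3 * (((P.L : ℝ) ^ e) ^ 2 * a) ^ 2 + N * δ ^ 2 ≤ 1 / 2)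
    (h : P.sitesPerDir i = P.L ^ e * P.sitesPerDir i') (f : Site P i → Matrix (Fin N) (Fin N) ℂ)
    (Φ : Site P i' → (Fin P.d → Fin (P.L ^ e)) → Matrix (Fin N) (Fin N) ℂ → Matrix (Fin N) (Fin N) ℂ)
    (hΦ : ∀ (y : Site P i') (r : Fin P.d → Fin (P.L ^ e)) (X : Matrix (Fin N) (Fin N) ℂ),
      ‖Φ y r X - conjR (holT V (Site.fibreSite i e y fun _ => ⟨0, pow_pos P.L_pos e⟩) (treeWord fun ν => ((r ν : ℕ) : ℤ))) X‖ ≤ δ * ‖X‖)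
    (hmean : ∀ y : Site P i', ∑ r : Fin P.d → Fin (P.L ^ e), Φ y r (f (Site.fibreSite i e y r)) = 0) :
    ∑ x : Site P i, ‖f x‖ ^ 2 ≤ (N / 2) * ((P.L : ℝ) ^ e) ^ 2 * ∑ ν : Fin P.d, ∑ x : Site P i, ‖conjR (V ⟨x, ν⟩) (f (x.shift ν)) - f x‖ ^ 2 := by
  have hmain := sum_normSq_le_combMean_add_covGrad hV ha hplaq h f
  -- the comb means against the reference means
  have hcard : (Fintype.card (Fin P.d → Fin (P.L ^ e)) : ℝ) = ((P.L : ℝ) ^ e) ^ P.d := by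
    rw [Fintype.card_fun, Fintype.card_fin, Fintype.card_fin]; push_cast; ring
  have hblock : ∀ y : Site P i', ‖∑ r : Fin P.d → Fin (P.L ^ e),
      conjR (holT V (Site.fibreSite i e y fun _ => ⟨0, pow_pos P.L_pos e⟩) (treeWord fun ν => ((r ν : ℕ) : ℤ))) (f (Site.fibreSite i e y r))‖ ^ 2
        ≤ δ ^ 2 * ((P.L : ℝ) ^ e) ^ P.d * ∑ r : Fin P.d → Fin (P.L ^ e), ‖f (Site.fibreSite i e y r)‖ ^ 2 := by
    intro y
    have := norm_sum_sub_le_of_ref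
      (fun r : Fin P.d → Fin (P.L ^ e) => fun X => conjR (holT V (Site.fibreSite i e y fun _ => ⟨0, pow_pos P.L_pos e⟩) (treeWord fun ν => ((r ν : ℕ) : ℤ))) X)
      (Φ y) (fun r => f (Site.fibreSite i e y r)) hδ (hΦ y) (hmean y)
    rw [hcard] at this
    exact this
  have hsumB : ∑ y : Site P i', ‖∑ r : Fin P.d → Fin (P.L ^ e),
      conjR (holT V (Site.fibreSite i e y fun _ => ⟨0, pow_pos P.L_pos e⟩) (treeWord fun ν => ((r ν : ℕ) : ℤ))) (f (Site.fibreSite i e y r))‖ ^ 2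
        ≤ δ ^ 2 * ((P.L : ℝ) ^ e) ^ P.d * ∑ x : Site P i, ‖f x‖ ^ 2 := by
    refine (Finset.sum_le_sum fun y _ => hblock y).trans (le_of_eq ?_)
    rw [← Finset.mul_sum, sum_chart P h (fun x => ‖f x‖ ^ 2)]
  have hLpos : (0 : ℝ) < ((P.L : ℝ) ^ e) ^ P.d := by have := P.L_pos; positivity
  have hN0 : (0 : ℝ) ≤ N := Nat.cast_nonneg _
  have hm : (N : ℝ) * (((P.L : ℝ) ^ e) ^ P.d)⁻¹ * ∑ y : Site P i', ‖∑ r : Fin P.d → Fin (P.L ^ e),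
      conjR (holT V (Site.fibreSite i e y fun _ => ⟨0, pow_pos P.L_pos e⟩) (treeWord fun ν => ((r ν : ℕ) : ℤ))) (f (Site.fibreSite i e y r))‖ ^ 2
        ≤ N * δ ^ 2 * ∑ x : Site P i, ‖f x‖ ^ 2 := by
    have h1 := mul_le_mul_of_nonneg_left hsumB (by positivity : (0 : ℝ) ≤ N * (((P.L : ℝ) ^ e) ^ P.d)⁻¹)
    refine h1.trans (le_of_eq ?_)
    field_simp
  have hS0 : 0 ≤ ∑ x : Site P i, ‖f x‖ ^ 2 := Finset.sum_nonneg fun _ _ => sq_nonneg _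
  have hG0 : 0 ≤ ∑ ν : Fin P.d, ∑ x : Site P i, ‖conjR (V ⟨x, ν⟩) (f (x.shift ν)) - f x‖ ^ 2 :=
    Finset.sum_nonneg fun _ _ => Finset.sum_nonneg fun _ _ => sq_nonneg _
  have h2 := mul_le_mul_of_nonneg_right hsmall hS0
  nlinarith [hmain, hm, h2, hG0]

end Assembly

/-! ## §2 The T³ member in brick L0a's Hilbert letters -/

section T3

open Literature.MathematicalPhysics.QuantumFieldTheory.Balaban1983to89.T3ContinuumYM3Torus
open T3SectALandauChart (eta eta_pos)
open Summit.QuantumFields.YangMills.Theorems.Prop7SectET3Transport (bondEquiv bgOfCfg val_bgOfCfg isUnitaryBg_bgOfCfg)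
open Summit.QuantumFields.YangMills.Theorems.Prop7SectET3HilbertLetters (W₂ toL2 toL2S DL2 inner_toL2 DL2_apply)
open Summit.QuantumFields.YangMills.Theorems.Prop7SectET3RealCoordSums (inner_toL2S)

variable (F : T3Family) {n K : ℕ}

/-- **THE DICTIONARY, SITES**: `‖toL2S l‖² = c₀·Σ_xΣ_{jk}|l(x)_{jk}|²` (✓`inner_toL2S`, Frobenius). [cite: Balaban1985BackgroundPropagators, (3.11) p.392; Balaban1985Averaging, (18) p.21] -/
theorem normSq_toL2S_eq {c₀ : ℝ} [Fact (0 < c₀)] (l : Site (F.P K) 0 → Matrix (Fin 2) (Fin 2) ℂ) :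
    ‖toL2S F K c₀ l‖ ^ 2 = c₀ * ∑ x : Site (F.P K) 0, ∑ j : Fin 2, ∑ k : Fin 2, ‖l x j k‖ ^ 2 := by
  rw [← inner_self_eq_norm_sq (𝕜 := ℂ) (toL2S F K c₀ l)]
  simp only [RCLike.re_to_complex]
  rw [inner_toL2S, Complex.re_ofReal_mul, Complex.re_sum]
  congr 1
  refine Finset.sum_congr rfl fun x _ => ?_
  rw [MatrixNorms.sum_norm_sq_eq_re_trace]

/-- **THE DICTIONARY, BONDS**: `‖toL2 A‖² = c₀·Σ_bΣ_{jk}|A(b)_{jk}|²` (✓`inner_toL2`, Frobenius). [cite: Balaban1985BackgroundPropagators, (3.11) p.392; Balaban1985Averaging, (18) p.21] -/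
theorem normSq_toL2_eq {c₀ : ℝ} [Fact (0 < c₀)] (A : PBond (F.P K) 0 → Matrix (Fin 2) (Fin 2) ℂ) :
    ‖toL2 F K c₀ A‖ ^ 2 = c₀ * ∑ b : PBond (F.P K) 0, ∑ j : Fin 2, ∑ k : Fin 2, ‖A b j k‖ ^ 2 := by
  rw [← inner_self_eq_norm_sq (𝕜 := ℂ) (toL2 F K c₀ A)]
  simp only [RCLike.re_to_complex]
  rw [inner_toL2, Complex.re_ofReal_mul, Complex.re_sum]
  congr 1
  refine Finset.sum_congr rfl fun b _ => ?_
  rw [MatrixNorms.sum_norm_sq_eq_re_trace]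

/-- **THE DICTIONARY, COVARIANT GRADIENT**: `‖D^η_{U₀}(toL2S l)‖² ≥ c₀·η⁻²·Σ_b‖U₀(b)·l(b₊)·U₀(b)⋆ − l(b₋)‖²_op` — (3.3) read back by ✓`DL2_apply`, Frobenius ≥ operator norm
(✓`MatrixNorms.opNorm_sq_le_sum_norm_sq`), `U₀(b)⁻¹ = U₀(b)⋆`. [cite: Balaban1985BackgroundPropagators, (3.3) p.391, (3.11) p.392] -/
theorem mul_sum_normSq_covGrad_le_normSq_DL2 {c₀ : ℝ} [Fact (0 < c₀)] (U₀ : GaugeField (F.P K) 0 (Matrix.specialUnitaryGroup (Fin 2) ℂ))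
    (l : Site (F.P K) 0 → Matrix (Fin 2) (Fin 2) ℂ) :
    c₀ * ((eta F n K)⁻¹ ^ 2 * ∑ b : PBond (F.P K) 0,
        ‖((U₀ b : Matrix.specialUnitaryGroup (Fin 2) ℂ) : Matrix (Fin 2) (Fin 2) ℂ) * l b.tgt * star (((U₀ b : Matrix.specialUnitaryGroup (Fin 2) ℂ) : Matrix (Fin 2) (Fin 2) ℂ)) - l b.src‖ ^ 2)
      ≤ ‖DL2 F n K c₀ U₀ (toL2S F K c₀ l)‖ ^ 2 := by
  have hc : 0 < c₀ := Fact.out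
  have hη : 0 < eta F n K := eta_pos F n K
  set G : PBond (F.P K) 0 → Matrix (Fin 2) (Fin 2) ℂ := (toL2 F K c₀).symm (DL2 F n K c₀ U₀ (toL2S F K c₀ l)) with hGdef
  have hG : ∀ b, G b = (((eta F n K : ℝ) : ℂ)⁻¹) •
      (((U₀ b : Matrix.specialUnitaryGroup (Fin 2) ℂ) : Matrix (Fin 2) (Fin 2) ℂ) * l b.tgt * star (((U₀ b : Matrix.specialUnitaryGroup (Fin 2) ℂ) : Matrix (Fin 2) (Fin 2) ℂ)) - l b.src) := by
    intro b
    have hinv : ((((bgOfCfg F K U₀ (bondEquiv F K b))⁻¹ : (Matrix (Fin 2) (Fin 2) ℂ)ˣ) : Matrix (Fin 2) (Fin 2) ℂ)) =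
        star (((U₀ b : Matrix.specialUnitaryGroup (Fin 2) ℂ) : Matrix (Fin 2) (Fin 2) ℂ)) := by
      rw [isUnitaryBg_bgOfCfg, val_bgOfCfg, Equiv.symm_apply_apply]
    rw [hGdef, DL2_apply, hinv]
  have hback : DL2 F n K c₀ U₀ (toL2S F K c₀ l) = toL2 F K c₀ G := by rw [hGdef, LinearEquiv.apply_symm_apply]
  rw [hback, normSq_toL2_eq]
  refine mul_le_mul_of_nonneg_left ?_ hc.le
  rw [Finset.mul_sum]
  refine Finset.sum_le_sum fun b _ => ?_
  have h1 : ‖G b‖ ^ 2 ≤ ∑ j : Fin 2, ∑ k : Fin 2, ‖G b j k‖ ^ 2 := MatrixNorms.opNorm_sq_le_sum_norm_sq (G b)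
  refine le_trans (le_of_eq ?_) h1
  rw [hG, norm_smul, mul_pow, norm_inv, Complex.norm_real, Real.norm_of_nonneg hη.le]

/-- **THE DICTIONARY, SITES vs OPERATOR NORM**: `‖toL2S l‖² ≤ 2c₀·Σ_x‖l(x)‖²_op` (Frobenius `≤ N·`operator², `N = 2`; ✓`sum_norm_sq_le_mul_opNorm_sq`).
[cite: Balaban1985Averaging, (18)–(19) p.21] -/
theorem normSq_toL2S_le_two_mul {c₀ : ℝ} [Fact (0 < c₀)] (l : Site (F.P K) 0 → Matrix (Fin 2) (Fin 2) ℂ) :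
    ‖toL2S F K c₀ l‖ ^ 2 ≤ 2 * c₀ * ∑ x : Site (F.P K) 0, ‖l x‖ ^ 2 := by
  have hc : 0 < c₀ := Fact.out
  rw [normSq_toL2S_eq, mul_comm 2 c₀, mul_assoc]
  refine mul_le_mul_of_nonneg_left ?_ hc.le
  rw [Finset.mul_sum]
  refine Finset.sum_le_sum fun x _ => ?_
  have := sum_norm_sq_le_mul_opNorm_sq (N := 2) (l x)
  simpa using this

/-- the covariant forward derivative of the block-Poincaré letters IS the bracket of (3.3): `Ad_{U₀♭(b)}X = U₀(b)·X·U₀(b)⋆` (`U₀♭ = unitsField (toUField U₀)`, `U₀(b) ∈ SU(2)`).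
[cite: Balaban1985Averaging, (19) p.21; Balaban1985BackgroundPropagators, (3.3) p.391] -/
theorem conjR_unitsField_toUField (U₀ : GaugeField (F.P K) 0 (Matrix.specialUnitaryGroup (Fin 2) ℂ)) (b : PBond (F.P K) 0) (X : Matrix (Fin 2) (Fin 2) ℂ) :
    conjR (unitsField (toUField U₀) b) X =
      ((U₀ b : Matrix.specialUnitaryGroup (Fin 2) ℂ) : Matrix (Fin 2) (Fin 2) ℂ) * X * star (((U₀ b : Matrix.specialUnitaryGroup (Fin 2) ℂ) : Matrix (Fin 2) (Fin 2) ℂ)) := by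
  have hval : ((unitsField (toUField U₀) b : (Matrix (Fin 2) (Fin 2) ℂ)ˣ) : Matrix (Fin 2) (Fin 2) ℂ) =
      ((U₀ b : Matrix.specialUnitaryGroup (Fin 2) ℂ) : Matrix (Fin 2) (Fin 2) ℂ) := rfl
  have hinv : (((unitsField (toUField U₀) b)⁻¹ : (Matrix (Fin 2) (Fin 2) ℂ)ˣ) : Matrix (Fin 2) (Fin 2) ℂ) =
      star (((U₀ b : Matrix.specialUnitaryGroup (Fin 2) ℂ) : Matrix (Fin 2) (Fin 2) ℂ)) := by
    rw [← hval]
    exact Prop7CovariantCoercivity.coe_inv_eq_star (toUField U₀ b).2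
  rw [conjR_apply, hval, hinv]

/-- ★★★ **R2a — THE COVARIANT BLOCK POINCARÉ INEQUALITY ON THE KERNEL OF A REFERENCE BLOCK MEAN, IN BRICK L0a's LETTERS** ((Q1) of the (P2-core) plan v2).  At the T³ member
(`SU(2)`, finest lattice `Site (F.P K) 0`, top blocks `y : Site (F.P K) (K − n)`, block side `L^{K−n} = η⁻¹`): for a background `U₀` with `dist1(U₀(∂p)) ≤ ε·L^{−2(K−n)}` (the
plaquette clause of `𝔘_k(ε)`, non-strict), ANY reference coefficients `Φ y r : M₂ → M₂` within `δ` of the comb conjugations `Ad_{U₀(Γ_{ȳ,x_{y,r}})}` (`ȳ` the block corner, `Γ` the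
axial comb contour ✓`treeWord`), the window `108ε² + 4δ² ≤ 1`, and every gauge parameter `l` whose reference block means vanish (`Σ_r Φ y r (l x_{y,r}) = 0` for all `y`):
**`‖toL2S l‖² ≤ 2·‖D^η_{U₀}(toL2S l)‖²`** (`C_P = √2`, independent of `L`, `K − n`, and the volume).  The nested covariant block mean `ns_k` of the tower is such a reference family
(linearity of its recursion + tower closeness) — displayed by (`hΦ`, `hmean`), not derived here. [cite: Balaban1985BackgroundPropagators, Thm 3.11 p.416, (3.3) p.391, (3.21)–(3.23) p.394; Balaban1983RegularityDecay, (2.27) p.580; Balaban1985Averaging, pp.24–25; Balaban1985Variational, (14) p.280] -/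
theorem normSq_toL2S_le_two_mul_of_refMean_eq_zero {c₀ : ℝ} [Fact (0 < c₀)] (U₀ : GaugeField (F.P K) 0 (Matrix.specialUnitaryGroup (Fin 2) ℂ))
    {ε δ : ℝ} (hε : 0 ≤ ε) (hδ : 0 ≤ δ) (hwin : 108 * ε ^ 2 + 4 * δ ^ 2 ≤ 1)
    (hU : ∀ p : Plaq (F.P K) 0, dist1 (GaugeField.plaqHol U₀ p) ≤ ε * (((F.L : ℝ) ^ (K - n)) ^ 2)⁻¹)
    (Φ : Site (F.P K) (K - n) → (Fin (F.P K).d → Fin ((F.P K).L ^ (K - n))) → Matrix (Fin 2) (Fin 2) ℂ → Matrix (Fin 2) (Fin 2) ℂ)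
    (hΦ : ∀ (y : Site (F.P K) (K - n)) (r : Fin (F.P K).d → Fin ((F.P K).L ^ (K - n))) (X : Matrix (Fin 2) (Fin 2) ℂ),
      ‖Φ y r X - conjR (holT (unitsField (toUField U₀)) (Site.fibreSite 0 (K - n) y fun _ => ⟨0, pow_pos (F.P K).L_pos (K - n)⟩)
          (treeWord fun ν => ((r ν : ℕ) : ℤ))) X‖ ≤ δ * ‖X‖)
    (l : Site (F.P K) 0 → Matrix (Fin 2) (Fin 2) ℂ)
    (hmean : ∀ y : Site (F.P K) (K - n), ∑ r : Fin (F.P K).d → Fin ((F.P K).L ^ (K - n)), Φ y r (l (Site.fibreSite 0 (K - n) y r)) = 0) :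
    ‖toL2S F K c₀ l‖ ^ 2 ≤ 2 * ‖DL2 F n K c₀ U₀ (toL2S F K c₀ l)‖ ^ 2 := by
  obtain ⟨hV, hplaq⟩ := hyp_of_specialUnitary U₀ hU
  have hc : 0 < c₀ := Fact.out
  have hLF : ((F.P K).L : ℝ) = (F.L : ℝ) := by norm_cast
  have hd : ((F.P K).d : ℝ) = 3 := by norm_num [T3ContinuumYM3Torus.T3Family.P_d]
  have hLpos : (0 : ℝ) < F.L := by have := F.hL.2; exact_mod_cast (by omega : 0 < F.L)
  have hL0 : (0 : ℝ) < ((F.L : ℝ) ^ (K - n)) ^ 2 := by positivity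
  -- the window in the generic letters: `N d³((L^e)²a)² + Nδ² ≤ ½` at `N = 2`, `d = 3`, `(L^e)²a = ε`
  have hsmall : ((2 : ℕ) : ℝ) * (F.P K).d ^ 3 * ((((F.P K).L : ℝ) ^ (K - n)) ^ 2 * (ε * (((F.L : ℝ) ^ (K - n)) ^ 2)⁻¹)) ^ 2 + ((2 : ℕ) : ℝ) * δ ^ 2 ≤ 1 / 2 := by
    rw [hLF, hd]
    have e1 : ((F.L : ℝ) ^ (K - n)) ^ 2 * (ε * (((F.L : ℝ) ^ (K - n)) ^ 2)⁻¹) = ε := by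
      rw [mul_comm ε, ← mul_assoc, mul_inv_cancel₀ hL0.ne', one_mul]
    rw [e1]
    push_cast
    nlinarith [hwin]
  -- the generic inequality on the kernel of the reference mean
  have hgen := sum_normSq_le_covGrad_of_refMean_eq_zero hV (by positivity) hδ hplaq hsmall (Prop7FlatCoercivity.sitesPerDir_T3 F n K) l Φ hΦ hmean
  rw [hLF] at hgen
  -- the gradient sum in (3.3)'s letters
  have hη : 0 < eta F n K := eta_pos F n K
  have hηL : (eta F n K)⁻¹ = (F.L : ℝ) ^ (K - n) := by
    rw [T3SectALandauChart.eta, ← inv_pow, inv_inv]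
  have eG : ∑ ν : Fin (F.P K).d, ∑ x : Site (F.P K) 0, ‖conjR (unitsField (toUField U₀) ⟨x, ν⟩) (l (x.shift ν)) - l x‖ ^ 2
      = ∑ b : PBond (F.P K) 0,
        ‖((U₀ b : Matrix.specialUnitaryGroup (Fin 2) ℂ) : Matrix (Fin 2) (Fin 2) ℂ) * l b.tgt * star (((U₀ b : Matrix.specialUnitaryGroup (Fin 2) ℂ) : Matrix (Fin 2) (Fin 2) ℂ)) - l b.src‖ ^ 2 := by
    rw [B10StarCount.sum_pbond, Finset.sum_comm]
    refine Finset.sum_congr rfl fun ν _ => Finset.sum_congr rfl fun x _ => ?_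
    rw [conjR_unitsField_toUField]
    rfl
  have hgrad := mul_sum_normSq_covGrad_le_normSq_DL2 F (n := n) (c₀ := c₀) U₀ l
  rw [hηL, ← eG] at hgrad
  -- assemble: `‖toL2S l‖² ≤ 2c₀Σ‖l‖²_op ≤ 2c₀·(L^{K−n})²Σ‖∇l‖²_op ≤ 2‖DL2(toL2S l)‖²`
  have h1 := normSq_toL2S_le_two_mul F (K := K) (c₀ := c₀) l
  have h2 : 2 * c₀ * ∑ x : Site (F.P K) 0, ‖l x‖ ^ 2
      ≤ 2 * c₀ * (((2 : ℕ) : ℝ) / 2 * ((F.L : ℝ) ^ (K - n)) ^ 2 *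
          ∑ ν : Fin (F.P K).d, ∑ x : Site (F.P K) 0, ‖conjR (unitsField (toUField U₀) ⟨x, ν⟩) (l (x.shift ν)) - l x‖ ^ 2) :=
    mul_le_mul_of_nonneg_left hgen (by positivity)
  have h3 : 2 * c₀ * (((2 : ℕ) : ℝ) / 2 * ((F.L : ℝ) ^ (K - n)) ^ 2 *
          ∑ ν : Fin (F.P K).d, ∑ x : Site (F.P K) 0, ‖conjR (unitsField (toUField U₀) ⟨x, ν⟩) (l (x.shift ν)) - l x‖ ^ 2)
      = 2 * (c₀ * (((F.L : ℝ) ^ (K - n)) ^ 2 *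
          ∑ ν : Fin (F.P K).d, ∑ x : Site (F.P K) 0, ‖conjR (unitsField (toUField U₀) ⟨x, ν⟩) (l (x.shift ν)) - l x‖ ^ 2)) := by
    push_cast; ring
  rw [h3] at h2
  linarith [h1, h2, hgrad]

end T3

end Summit.QuantumFields.YangMills.Theorems.Prop7NestedMeanPoincare

end
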